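import Summits.QuantumFields.YangMills.Theorems.LangevinControlUVOSLegsFromFemtoAndGapDefs
import Summits.QuantumFields.YangMills.Theorems.LangevinControlUVOSLegsFromFemtoAndGapStubCollar
import Literature.MathematicalPhysics.QuantumLattice.LatticeGaugeDLRFarFactorProofs
import Literature.MathematicalPhysics.QuantumLattice.ContinuumLimitLGT
import Literature.MathematicalPhysics.QuantumFieldTheory.LatticeGaugeProofs

/-!
# Stub `stub_collar6` of line `dlr-collar-transfer` (crux stmt-QuantumFields-9367, reshape r2): FBL6 ⇒ MomentBounds6

`Summit.QuantumFields.YangMills.Cruxes.OSLegsFromFemtoAndGap.DlrCollarTransfer.stub_collar6 : Statement.stub_collar6`,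
i.e. for every compact `G`, lattice representation `r` and unit map `a`, `FBL6 G r a → MomentBounds6 G r a`: the
plane-resolved frozen-boundary femto law (kernel means of the single-plane plaquette field of orientation `q` at
depth `d` are within `C₁/d⁴` of `p q β`, for EVERY exterior) transfers to `(2C₁/R⁴)ⁿ` bounds on the centred mixed
moments of the single-plane fields `plane (q i) (x i)` at pairwise torus-separated sites, on EVERY odd torus
`(ℤ/(2L+1))⁴` with `4R+8 ≤ L`.

Proof: the landed proof of `stub_collar` (`LangevinControlUVOSLegsFromFemtoAndGapStubCollar.lean`), generic in the
observable.  The tree's `abs_integral_prod_sub_mean_le` (`LatticeGaugeDLRFarFactorProofs.lean`: one torus DLR step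
per site, the other factors forming the far factor) is instantiated with the volumes `Λᵢ = cubeEdges (xᵢ − (R+1))
(2R+3)` (radius-`R+1` cube centred at `xᵢ`, centre depth `R+2`) and the SHIFTED observables
`Aᵢ = plane (qᵢ) (xᵢ) − p (qᵢ) β` (the engine wants one reference value common to all `i`; after the shift it is
`0`, and the shift cancels in `Aᵢ − ⟨Aᵢ⟩`).  The support of `plane q x` is one origin plaquette support shifted
to `x`, contained in the shifted curvature support of the action density, so the cube/injectivity/separation
geometry of the landed file (§1 there) applies verbatim; `FBL6` at depth `R+2` gives `ε = C₁/(R+2)⁴ ≤ C₁/R⁴`.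
Constants: `C = 2C₁`, `β₄ = β₁`, `ℓ₄ = ℓ₁/5`.
-/

set_option autoImplicit false

noncomputable section

open scoped SchwartzMap
open MeasureTheory Filter Topology
open Literature.MathematicalPhysics.QuantumFieldTheory Literature.MathematicalPhysics.QuantumLattice
open Literature.MathematicalPhysics.AQFT Literature.Probability.LatticeModels

namespace Summit.QuantumFields.YangMills.Cruxes.OSLegsFromFemtoAndGap.DlrCollarTransfer

/-! ## §1 The single-plane plaquette field at a site: continuity, uniform bound, support -/

section PlaneGeometry

variable {G : Type} [Group G] [TopologicalSpace G] [IsTopologicalGroup G] [CompactSpace G]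
  [MeasurableSpace G] [BorelSpace G] (r : LatticeRep G)

omit [CompactSpace G] [BorelSpace G] in
/-- The single-plane field of orientation `q` at `x` is continuous. [folklore] -/
theorem continuous_plane (q : Fin 4 × Fin 4) (x : Fin 4 → ℤ) : Continuous (plane G r q x) :=
  (continuous_plaquetteObs r.ρ r.continuous 0 q.1 q.2).comp (continuous_configShift (-x))

omit [BorelSpace G] in
/-- The single-plane fields are bounded uniformly in the orientation and the site (sixteen continuous functions
on a compact configuration space, translated). [folklore] -/
theorem exists_abs_plane_le :
    ∃ C : ℝ, ∀ (q : Fin 4 × Fin 4) (x : Fin 4 → ℤ) (U : LGConfig 4 G), |plane G r q x U| ≤ C := by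
  choose C hC using fun q : Fin 4 × Fin 4 => exists_abs_plaquetteObs_le r.ρ r.continuous (0 : Fin 4 → ℤ) q.1 q.2
  refine ⟨∑ q, |C q|, fun q x U => ?_⟩
  calc |plane G r q x U| ≤ C q := hC q (configShift (-x) U)
    _ ≤ |C q| := le_abs_self _
    _ ≤ ∑ q', |C q'| := Finset.single_le_sum (f := fun q' => |C q'|) (fun q' _ => abs_nonneg _) (Finset.mem_univ q)

omit [IsTopologicalGroup G] [CompactSpace G] [BorelSpace G] in
/-- The single-plane field at `x` is a cylinder observable on the translate by `x` of its origin plaquette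
support. [folklore] -/
theorem isCylinder_plane (q : Fin 4 × Fin 4) (x : Fin 4 → ℤ) :
    IsCylinder (plane G r q x) ((originPlaquetteSupport q.1 q.2).image fun e => (e.1 - -x, e.2)) :=
  IsCylinder.comp_configShift (isCylinder_plaquetteObs_zero r.ρ q.1 q.2) (-x)

/-- The support of the single-plane field at `x` is based at sites `y` with `0 ≤ y − x ≤ 1` coordinatewise
(the four edges `(x, i), (x + eᵢ, j), (x + eⱼ, i), (x, j)`). [folklore] -/
theorem near_of_mem_supp_plane {q : Fin 4 × Fin 4} {x : Fin 4 → ℤ}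
    {e : Literature.MathematicalPhysics.QuantumLattice.ZdEdge 4}
    (he : e ∈ (originPlaquetteSupport q.1 q.2).image fun e => (e.1 - -x, e.2)) (j : Fin 4) :
    0 ≤ e.1 j - x j ∧ e.1 j - x j ≤ 1 := by
  obtain ⟨e', he', rfl⟩ := Finset.mem_image.1 he
  simp only [originPlaquetteSupport, Finset.mem_insert, Finset.mem_singleton] at he'
  simp only [sub_neg_eq_add, Pi.add_apply, add_sub_cancel_right]
  rcases he' with rfl | rfl | rfl | rfl <;> simp [Pi.single_apply] <;> split_ifs <;> simp

omit [IsTopologicalGroup G] [CompactSpace G] [BorelSpace G] in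
/-- For `R ≥ 1` the single-plane field at `x` is a cylinder observable on the interior links of the cube of
side `2R+3` based at `x − (R+1)` (its support is based at `x`, `x + eᵢ`, with both endpoints in `x + [0, 2]⁴`).
[folklore] -/
theorem isCylinder_plane_cube {R : ℕ} (hR : 1 ≤ R) (q : Fin 4 × Fin 4) (x : Fin 4 → ℤ) :
    IsCylinder (plane G r q x) (cubeEdges (fun k => x k - (R + 1)) (2 * R + 3)) := by
  refine (isCylinder_plane r q x).mono (Finset.coe_subset.2 fun e he => ?_)
  have h01 := near_of_mem_supp_plane he
  unfold cubeEdges cubeSites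
  simp only [Finset.mem_filter, Finset.mem_product, Finset.mem_univ, and_true, Fintype.mem_piFinset,
    Finset.mem_Ico, Pi.add_apply, Pi.single_apply]
  refine ⟨fun j => ?_, fun j => ?_⟩
  · obtain ⟨h0, h1⟩ := h01 j
    push_cast
    constructor <;> omega
  · obtain ⟨h0, h1⟩ := h01 j
    split_ifs <;> push_cast <;> constructor <;> omega

end PlaneGeometry

/-! ## §2 FBL6 at the centre of the cube; the stub -/

section Transfer

variable {G : Type} [Group G] [TopologicalSpace G] [IsTopologicalGroup G] [CompactSpace G]
  [MeasurableSpace G] [BorelSpace G] (r : LatticeRep G)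

/-- FBL6 at the centre (depth `R+2`) of the cube of side `2R+3` around `x`: the kernel mean of the single-plane
field of orientation `q` (`q.1 < q.2`) at `x` is within `C₁/R⁴` of `p q β`, for every exterior. [folklore] -/
theorem abs_kerE_plane_centred_sub_le {aβ C₁ ℓ₁ β : ℝ} {p : Fin 4 × Fin 4 → ℝ → ℝ} (hC₁ : 0 ≤ C₁)
    (hF : ∀ (c : Fin 4 → ℤ) (b : ℕ), (b : ℝ) * aβ ≤ ℓ₁ → ∀ (η : LGConfig 4 G) (q : Fin 4 × Fin 4)
      (x : Fin 4 → ℤ), q.1 < q.2 → 2 ≤ depth c b x →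
        |kerE G r β c b η (plane G r q x) - p q β| ≤ C₁ / (depth c b x : ℝ) ^ 4)
    {q : Fin 4 × Fin 4} (hq : q.1 < q.2) {R : ℕ} (hR : 1 ≤ R) (hb : ((2 * R + 3 : ℕ) : ℝ) * aβ ≤ ℓ₁)
    (x : Fin 4 → ℤ) (η : LGConfig 4 G) :
    |kerE G r β (fun k => x k - (R + 1)) (2 * R + 3) η (plane G r q x) - p q β| ≤ C₁ / (R : ℝ) ^ 4 := by
  have hd := depth_centred x R
  have h1 := hF (fun k => x k - (R + 1)) (2 * R + 3) hb η q x hq (by rw [hd]; omega)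
  rw [hd] at h1
  refine h1.trans ?_
  have hR' : (0 : ℝ) < R := Nat.cast_pos.2 hR
  push_cast
  refine div_le_div_of_nonneg_left hC₁ (pow_pos hR' 4) ?_
  gcongr
  linarith

/-- Registered stub `stub_collar6` (plane-resolved CollarTransfer): `FBL6 G r a → MomentBounds6 G r a` for every
compact `G`, lattice representation `r` and unit map `a` — the plane-resolved frozen-boundary femto law collars
to `(2C₁/R⁴)ⁿ` centred mixed-moment bounds for strings of single-plane fields on every odd torus, by one torus DLR
step per site (tree `abs_integral_prod_sub_mean_le`, applied to the shifted observables `plane (qᵢ) (xᵢ) − p (qᵢ) β`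
with common reference value `0`) on the radius-`R+1` cubes around the sites. [folklore] -/
theorem stub_collar6 : Statement.stub_collar6 := by
  intro G _ _ _ _ _ _ r a hFBL
  obtain ⟨C₁, β₁, ℓ₁, p, hℓ₁, hC₁, hF⟩ := hFBL
  refine ⟨2 * C₁, β₁, ℓ₁ / 5, by positivity, by positivity, ?_⟩
  intro β hβ L n q x R hq hR hRa hRL hsep
  haveI : SecondCountableTopology G :=
    (r.continuous.isClosedEmbedding r.injective).isEmbedding.secondCountableTopology
  haveI := isProbabilityMeasure_wilsonMeasure (d := 4) (L := 2 * L + 1) r.ρ r.continuous β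
  obtain ⟨CA, hCA⟩ := exists_abs_plane_le r
  -- the cubes of side `2R+3` are femto cubes
  have hb : ((2 * R + 3 : ℕ) : ℝ) * a β ≤ ℓ₁ := by
    rcases le_or_gt 0 (a β) with ha | ha
    · have h5 : ((2 * R + 3 : ℕ) : ℝ) ≤ 5 * R := by
        have : (1 : ℝ) ≤ R := by exact_mod_cast hR
        push_cast
        linarith
      calc ((2 * R + 3 : ℕ) : ℝ) * a β ≤ 5 * R * a β := mul_le_mul_of_nonneg_right h5 ha
        _ = 5 * ((R : ℝ) * a β) := by ring
        _ ≤ 5 * (ℓ₁ / 5) := by gcongr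
        _ = ℓ₁ := by ring
    · have : ((2 * R + 3 : ℕ) : ℝ) * a β ≤ 0 := mul_nonpos_of_nonneg_of_nonpos (by positivity) ha.le
      linarith
  -- the data of the abstract collar bound (tree `abs_integral_prod_sub_mean_le`): volumes = supports = the cubes,
  -- observables shifted by their reference values `p (q i) β` so that the common reference value is `0`
  have hmeas : ∀ i : Fin n, Measurable (plane G r (q i) (x i)) := fun i =>
    (continuous_plane r (q i) (x i)).measurable
  have hAc : ∀ i : Fin n, Continuous fun U => plane G r (q i) (x i) U - p (q i) β := fun i =>
    (continuous_plane r (q i) (x i)).sub continuous_const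
  have hAb : ∀ (i : Fin n) (U : LGConfig 4 G), |plane G r (q i) (x i) U - p (q i) β| ≤ CA + ∑ j, |p (q j) β| :=
    fun i U => (abs_sub _ _).trans (add_le_add (hCA _ _ _)
      (Finset.single_le_sum (f := fun j => |p (q j) β|) (fun j _ => abs_nonneg _) (Finset.mem_univ i)))
  have hAS : ∀ i : Fin n, IsCylinder (fun U => plane G r (q i) (x i) U - p (q i) β)
      (cubeEdges (fun k => x i k - (R + 1)) (2 * R + 3)) :=
    fun i U V hUV => by simp only [isCylinder_plane_cube r hR (q i) (x i) hUV]
  have hinj : ∀ i : Fin n, Set.InjOn (Torus.proj (2 * L + 1))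
      (((cubeEdges (fun k => x i k - (R + 1)) (2 * R + 3) ∪ cubeEdges (fun k => x i k - (R + 1)) (2 * R + 3) ∪
          (plaquettesTouching (cubeEdges (fun k => x i k - (R + 1)) (2 * R + 3))).biUnion plaquetteEdges).image
          Prod.fst : Set (Fin 4 → ℤ))) := fun i => injOn_torusProj_cube hRL (x i)
  have hfar : ∀ i j : Fin n, i ≠ j → ∀ e ∈ cubeEdges (fun k => x j k - (R + 1)) (2 * R + 3) ∪
      (plaquettesTouching (cubeEdges (fun k => x j k - (R + 1)) (2 * R + 3))).biUnion plaquetteEdges,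
      ∀ e' ∈ cubeEdges (fun k => x i k - (R + 1)) (2 * R + 3),
      torusEdge (2 * L + 1) e ≠ torusEdge (2 * L + 1) e' :=
    fun i j hij e he e' he' => torusEdge_ne_cube (hsep i j hij) he he'
  have hm : ∀ i : Fin n, torusE G r β L (plane G r (q i) (x i)) - p (q i) β =
      ∫ W, (plane G r (q i) (x i) (torusLift (2 * L + 1) W) - p (q i) β)
        ∂(wilsonMeasure (d := 4) (L := 2 * L + 1) r.ρ β) := fun i =>
    (integral_sub_const_of_abs_le (μ := wilsonMeasure (d := 4) (L := 2 * L + 1) r.ρ β)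
      ((continuous_plane r (q i) (x i)).comp (continuous_torusLift (2 * L + 1))).measurable
      (fun W => hCA (q i) (x i) (torusLift (2 * L + 1) W)) (p (q i) β)).symm
  have hker : ∀ (i : Fin n) (η : LGConfig 4 G),
      |(∫ U, (plane G r (q i) (x i) U - p (q i) β) ∂(ymSpecification r.ρ β
        (cubeEdges (fun k => x i k - (R + 1)) (2 * R + 3)) η)) - 0| ≤ C₁ / (R : ℝ) ^ 4 := fun i η => by
    haveI := isProbabilityMeasure_ymSpecification r.ρ r.continuous β
      (cubeEdges (fun k => x i k - (R + 1)) (2 * R + 3)) η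
    rw [sub_zero, integral_sub_const_of_abs_le (hmeas i) (fun U => hCA (q i) (x i) U) (p (q i) β)]
    exact abs_kerE_plane_centred_sub_le r hC₁ (hF β hβ) (hq i) hR hb (x i) η
  have key : |∫ V, ∏ i, (plane G r (q i) (x i) (torusLift (2 * L + 1) V) - p (q i) β -
      (torusE G r β L (plane G r (q i) (x i)) - p (q i) β)) ∂(wilsonMeasure (d := 4) (L := 2 * L + 1) r.ρ β)| ≤
      (2 * (C₁ / (R : ℝ) ^ 4)) ^ n :=
    abs_integral_prod_sub_mean_le (d := 4) r.ρ r.continuous β (L := 2 * L + 1) (n := n)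
      (fun i => cubeEdges (fun k => x i k - (R + 1)) (2 * R + 3))
      (fun i => cubeEdges (fun k => x i k - (R + 1)) (2 * R + 3))
      (fun i U => plane G r (q i) (x i) U - p (q i) β) hAc hAb hAS hinj hfar
      (fun i => torusE G r β L (plane G r (q i) (x i)) - p (q i) β) hm hker
  simp only [sub_sub_sub_cancel_right] at key
  rw [show (2 : ℝ) * C₁ / (R : ℝ) ^ 4 = 2 * (C₁ / (R : ℝ) ^ 4) from mul_div_assoc _ _ _]
  exact key

end Transfer

end Summit.QuantumFields.YangMills.Cruxes.OSLegsFromFemtoAndGap.DlrCollarTransfer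

end
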